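import Literature.Probability.LatticeModels.IsoradialPercolation
import Literature.Probability.Percolation.Percolation
import HarnessLib

/-!
# The super-terminal quartic law `V4` implies the reverse-Harris row `P3_{1/2}` on every finite weighted graph (event level)

Support file for crux `stmt-CriticalPhenomena-4575` (`NoHeavyLowerTail`), seat `prim-l12-p1` gen 25 (`--supports stmt-CriticalPhenomena-4575`);
memos `run/shared/lean/prim/prim-l12/FROM-prim-l12-p1-g24-TCB-SUPERTERMINAL.md` §2 and `FROM-prim-l12-p1-g25-PORT-CUBE-MAXPRINCIPLE.md`.
No definitions, no sorries, standard axioms.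

Bond percolation `μ = prodBernoulli w` on a finite vertex type, four vertices `s a b c` (root `s`, block partner `a`, singleton `b`, port `c`;
no distinctness needed).  Events (written inline): `F = (s↔a) ∩ (s↔b)ᶜ` (the pattern `sa|b` of `{s,a,b}`), `c ∤ T = (c↔s)ᶜ ∩ (c↔a)ᶜ ∩ (c↔b)ᶜ`.
The SUPER-TERMINAL QUARTIC LAW `V4` is `μ(F ∩ c∤T)⁴ ≤ μ(F ∩ (c↔s)ᶜ ∩ (c↔a)ᶜ)² · μ(F ∩ (c↔b)ᶜ)² · μ(c∤T)` (gen 24: `Q'⁴ ≤ I'_A² I'_b² I'_c`);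
its FACE is the row `P3_{1/2}`: `μ(F) · μ(c ↔ T) ≤ 2 · μ(F ∩ c↔T)`, i.e. `P(c ∼ {s,a,b} | s∼a, s≁b) ≥ ½ · P(c ∼ {s,a,b})`, which gives the one-sided
cluster bound `TCB'_{1/2}`, hence TCB and TT-CHORD for `E₃` (`IncStar.oneSided_of_superTerminal`, `IncStar.tcb_of_oneSided`, `…IncStarTwoSidedClusterBound`).
* `F_subset_union` — under `F`, the port cannot be joined both to the block and to `b` (else `s ↔ b`);
* `real_F_add`, `real_F_inter_compl_cIso` — the inclusion–exclusion bookkeeping `μ(F) + Q' = I'_A + I'_b`, `μ(F ∩ c↔T) = (I'_A − Q') + (I'_b − Q')`;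
* `p3_half_of_superTerminalQuartic` — **`V4 ⟹ P3_{1/2}`** on every finite weighted graph.  The face algebra (`q⁴ ≤ (q+u)²(q+t)²(q+s) ⟹
  q(1−q−s−t−u) ≤ (t+u)(1+s)`) is gen 24's `ThreePointIsoQuarticFace.face_one_of_isoQuartic`; it is re-derived here as a private lemma because the
  olean of that (accepted) file is not yet built on the farm — replace by the import when it is.
(`V4` itself is open; gen 25 reduces it to the port-cube convexity statement `(MAXDIR)`, cf. `…PortCubeMaxPrinciple`.)
-/

namespace Summit.CriticalPhenomena.PercolationContinuityZ3.Theorems.SuperTerminalQuarticFace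

open MeasureTheory Set
open Literature.Probability.Percolation Literature.Probability.LatticeModels
open scoped Classical

variable {V : Type*} [Fintype V]

/-- The quartic face algebra (= `ThreePointIsoQuarticFace.face_one_of_isoQuartic`, re-derived privately; see the module docstring):
for `q, s, t, u ≥ 0` with `q⁴ ≤ (q+u)²(q+t)²(q+s)`, `q(1−q−s−t−u) ≤ (t+u)(1+s)`. [this work] -/
private theorem face_one_aux {q s t u : ℝ} (hq : 0 ≤ q) (hs : 0 ≤ s) (ht : 0 ≤ t) (hu : 0 ≤ u)
    (h4 : q ^ 4 ≤ (q + u) ^ 2 * (q + t) ^ 2 * (q + s)) :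
    q * (1 - q - s - t - u) ≤ (t + u) * (1 + s) := by
  set m := q + (t + u) / 2 with hm
  have hm0 : 0 ≤ m := by positivity
  have hP0 : 0 ≤ (q + u) * (q + t) := by positivity
  have hP : (q + u) * (q + t) ≤ m ^ 2 := by rw [hm]; nlinarith [sq_nonneg (t - u)]
  have hP2 : ((q + u) * (q + t)) ^ 2 ≤ (m ^ 2) ^ 2 := pow_le_pow_left₀ hP0 hP 2
  have hqs : 0 ≤ q + s := by positivity
  have hH : q ^ 4 ≤ m ^ 4 * (q + s) := by
    calc q ^ 4 ≤ (q + u) ^ 2 * (q + t) ^ 2 * (q + s) := h4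
      _ = ((q + u) * (q + t)) ^ 2 * (q + s) := by ring
      _ ≤ (m ^ 2) ^ 2 * (q + s) := mul_le_mul_of_nonneg_right hP2 hqs
      _ = m ^ 4 * (q + s) := by ring
  have hR : 0 ≤ (q + (t + u)) * (m ^ 4 * (q + s) - q ^ 4) +
      (t + u) ^ 2 * (q ^ 3 / 2 + q ^ 2 * (t + u) + 7 / 16 * q * (t + u) ^ 2 + (t + u) ^ 3 / 16) := by
    have h1 : 0 ≤ (q + (t + u)) * (m ^ 4 * (q + s) - q ^ 4) := mul_nonneg (by positivity) (by linarith)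
    have h2 : 0 ≤ (t + u) ^ 2 * (q ^ 3 / 2 + q ^ 2 * (t + u) + 7 / 16 * q * (t + u) ^ 2 + (t + u) ^ 3 / 16) := by
      positivity
    linarith
  have key : m ^ 4 * ((t + u) * (1 + s) - q * (1 - q - s - t - u)) =
      (q + (t + u)) * (m ^ 4 * (q + s) - q ^ 4) +
        (t + u) ^ 2 * (q ^ 3 / 2 + q ^ 2 * (t + u) + 7 / 16 * q * (t + u) ^ 2 + (t + u) ^ 3 / 16) := by
    rw [hm]; ring
  rcases eq_or_lt_of_le hm0 with h0 | hpos
  · have hq0 : q = 0 := by rw [hm] at h0; linarith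
    have htu : t + u = 0 := by rw [hm] at h0; linarith
    rw [hq0, htu]; simp
  · have h4pos : 0 < m ^ 4 := by positivity
    have hX : 0 ≤ (t + u) * (1 + s) - q * (1 - q - s - t - u) :=
      (mul_nonneg_iff_of_pos_left h4pos).mp (key ▸ hR)
    linarith

omit [Fintype V] in
/-- Under `F = (s↔a) ∩ (s↔b)ᶜ` the port `c` is separated from the block `{s,a}` or from `b`:
`F ⊆ ((c↔s)ᶜ ∩ (c↔a)ᶜ) ∪ (c↔b)ᶜ`. [this work] -/
theorem F_subset_union (s a b c : V) :
    (openConn s a ∩ (openConn s b)ᶜ : Set (BondConfig V)) ⊆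
      ((openConn c s)ᶜ ∩ (openConn c a)ᶜ) ∪ (openConn c b)ᶜ := by
  intro ω hω
  simp only [mem_inter_iff, mem_compl_iff, mem_union, openConn, mem_setOf_eq] at hω ⊢
  obtain ⟨hsa, hsb⟩ := hω
  by_cases hcb : (openGraph ω).Reachable c b
  · left
    exact ⟨fun hcs => hsb (hcs.symm.trans hcb), fun hca => hsb ((hsa.trans hca.symm).trans hcb)⟩
  · right; exact hcb

/-- Inclusion–exclusion under `F`: `μ(F) + μ(F ∩ c∤T) = μ(F ∩ c∤{s,a}) + μ(F ∩ (c↔b)ᶜ)`. [this work] -/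
theorem real_F_add (w : Sym2 V → unitInterval) (s a b c : V) :
    (prodBernoulli w).real (openConn s a ∩ (openConn s b)ᶜ : Set (BondConfig V)) +
      (prodBernoulli w).real (openConn s a ∩ (openConn s b)ᶜ ∩ ((openConn c s)ᶜ ∩ (openConn c a)ᶜ ∩ (openConn c b)ᶜ)) =
    (prodBernoulli w).real (openConn s a ∩ (openConn s b)ᶜ ∩ ((openConn c s)ᶜ ∩ (openConn c a)ᶜ)) +
      (prodBernoulli w).real (openConn s a ∩ (openConn s b)ᶜ ∩ (openConn c b)ᶜ) := by
  set μ := prodBernoulli w with hμ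
  set F : Set (BondConfig V) := openConn s a ∩ (openConn s b)ᶜ with hF
  set A : Set (BondConfig V) := (openConn c s)ᶜ ∩ (openConn c a)ᶜ with hA
  set B : Set (BondConfig V) := (openConn c b)ᶜ with hB
  have hsub : F ⊆ A ∪ B := F_subset_union s a b c
  have e1 : F ∩ (A ∪ B) = F := inter_eq_left.mpr hsub
  have hie : μ.real (F ∩ A ∪ F ∩ B) + μ.real (F ∩ A ∩ (F ∩ B)) = μ.real (F ∩ A) + μ.real (F ∩ B) :=
    measureReal_union_add_inter MeasurableSet.of_discrete
  have e2 : F ∩ A ∪ F ∩ B = F := by rw [← inter_union_distrib_left, e1]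
  have e3 : F ∩ A ∩ (F ∩ B) = F ∩ (A ∩ B) := by
    ext ω; simp only [mem_inter_iff]; tauto
  rw [e2, e3] at hie
  have e4 : (A ∩ B : Set (BondConfig V)) = (openConn c s)ᶜ ∩ (openConn c a)ᶜ ∩ (openConn c b)ᶜ := by rw [hA, hB]
  rw [e4] at hie
  exact hie

/-- `μ(F ∩ c↔T) = μ(F) − μ(F ∩ c∤T)`, with `c ↔ T = (c∤T)ᶜ`. [this work] -/
theorem real_F_inter_compl_cIso (w : Sym2 V → unitInterval) (s a b c : V) :
    (prodBernoulli w).real (openConn s a ∩ (openConn s b)ᶜ ∩ ((openConn c s)ᶜ ∩ (openConn c a)ᶜ ∩ (openConn c b)ᶜ)ᶜ : Set (BondConfig V)) =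
      (prodBernoulli w).real (openConn s a ∩ (openConn s b)ᶜ : Set (BondConfig V)) -
        (prodBernoulli w).real (openConn s a ∩ (openConn s b)ᶜ ∩ ((openConn c s)ᶜ ∩ (openConn c a)ᶜ ∩ (openConn c b)ᶜ)) := by
  have h := measureReal_inter_add_sdiff (μ := prodBernoulli w)
    (s := (openConn s a ∩ (openConn s b)ᶜ : Set (BondConfig V)))
    (t := ((openConn c s)ᶜ ∩ (openConn c a)ᶜ ∩ (openConn c b)ᶜ : Set (BondConfig V))) MeasurableSet.of_discrete
  rw [sdiff_eq] at h
  linarith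

/-- **`V4 ⟹ P3_{1/2}` on every finite weighted graph.**  If the super-terminal quartic law
`μ(F ∩ c∤T)⁴ ≤ μ(F ∩ c∤{s,a})² · μ(F ∩ (c↔b)ᶜ)² · μ(c∤T)` holds for `μ = prodBernoulli w` and vertices `s a b c`
(`F = (s↔a) ∩ (s↔b)ᶜ`, `c∤T = (c↔s)ᶜ ∩ (c↔a)ᶜ ∩ (c↔b)ᶜ`), then `μ(F) · μ(c↔T) ≤ 2 · μ(F ∩ c↔T)`: conditioning on the pattern `sa|b`
costs the increasing event `c ↔ {s,a,b}` at most a factor `½`.  [this work] -/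
theorem p3_half_of_superTerminalQuartic (w : Sym2 V → unitInterval) (s a b c : V)
    (hV4 : (prodBernoulli w).real (openConn s a ∩ (openConn s b)ᶜ ∩ ((openConn c s)ᶜ ∩ (openConn c a)ᶜ ∩ (openConn c b)ᶜ) : Set (BondConfig V)) ^ 4 ≤
      (prodBernoulli w).real (openConn s a ∩ (openConn s b)ᶜ ∩ ((openConn c s)ᶜ ∩ (openConn c a)ᶜ) : Set (BondConfig V)) ^ 2 *
      (prodBernoulli w).real (openConn s a ∩ (openConn s b)ᶜ ∩ (openConn c b)ᶜ : Set (BondConfig V)) ^ 2 *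
      (prodBernoulli w).real ((openConn c s)ᶜ ∩ (openConn c a)ᶜ ∩ (openConn c b)ᶜ : Set (BondConfig V))) :
    (prodBernoulli w).real (openConn s a ∩ (openConn s b)ᶜ : Set (BondConfig V)) *
        (prodBernoulli w).real ((openConn c s)ᶜ ∩ (openConn c a)ᶜ ∩ (openConn c b)ᶜ : Set (BondConfig V))ᶜ ≤
      2 * (prodBernoulli w).real (openConn s a ∩ (openConn s b)ᶜ ∩ ((openConn c s)ᶜ ∩ (openConn c a)ᶜ ∩ (openConn c b)ᶜ)ᶜ : Set (BondConfig V)) := by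
  set μ := prodBernoulli w with hμ
  set F : Set (BondConfig V) := openConn s a ∩ (openConn s b)ᶜ with hF
  set I : Set (BondConfig V) := (openConn c s)ᶜ ∩ (openConn c a)ᶜ ∩ (openConn c b)ᶜ with hI
  set IA : Set (BondConfig V) := (openConn c s)ᶜ ∩ (openConn c a)ᶜ with hIA
  set IB : Set (BondConfig V) := (openConn c b)ᶜ with hIB
  -- the four coordinates and the cells
  set q : ℝ := μ.real (F ∩ I) with hq
  set u : ℝ := μ.real (F ∩ IA) - q with hu
  set t : ℝ := μ.real (F ∩ IB) - q with ht
  set σ : ℝ := μ.real I - q with hσ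
  -- nonnegativity of the cells (monotonicity of `μ`)
  have hq0 : 0 ≤ q := measureReal_nonneg
  have hmono : ∀ {X Y : Set (BondConfig V)}, X ⊆ Y → μ.real X ≤ μ.real Y := fun h =>
    measureReal_mono h (measure_ne_top μ _)
  have hu0 : 0 ≤ u := by
    have : μ.real (F ∩ I) ≤ μ.real (F ∩ IA) :=
      hmono (inter_subset_inter_right _ (by rw [hI, hIA]; exact inter_subset_left))
    rw [hu]; linarith
  have ht0 : 0 ≤ t := by
    have : μ.real (F ∩ I) ≤ μ.real (F ∩ IB) :=
      hmono (inter_subset_inter_right _ (by rw [hI, hIB]; exact inter_subset_right))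
    rw [ht]; linarith
  have hσ0 : 0 ≤ σ := by
    have : μ.real (F ∩ I) ≤ μ.real I := hmono inter_subset_right
    rw [hσ]; linarith
  -- bookkeeping
  have hadd : μ.real F + q = μ.real (F ∩ IA) + μ.real (F ∩ IB) := real_F_add w s a b c
  have hN : μ.real (F ∩ Iᶜ) = μ.real F - q := real_F_inter_compl_cIso w s a b c
  have hIc : μ.real Iᶜ = 1 - μ.real I := by
    rw [measureReal_compl MeasurableSet.of_discrete, probReal_univ]
  have hle1 : μ.real F + μ.real I - q ≤ 1 := by
    -- `μ(F ∪ I) ≤ 1` and `μ(F ∪ I) + μ(F ∩ I) = μ(F) + μ(I)`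
    have h1 : μ.real (F ∪ I) + μ.real (F ∩ I) = μ.real F + μ.real I := measureReal_union_add_inter MeasurableSet.of_discrete
    have h2 : μ.real (F ∪ I) ≤ 1 := by
      calc μ.real (F ∪ I) ≤ μ.real (univ : Set (BondConfig V)) := hmono (subset_univ _)
        _ = 1 := probReal_univ
    linarith
  -- the face inequality from the quartic law
  have h4 : q ^ 4 ≤ (q + u) ^ 2 * (q + t) ^ 2 * (q + σ) := by
    have e1 : q + u = μ.real (F ∩ IA) := by rw [hu]; ring
    have e2 : q + t = μ.real (F ∩ IB) := by rw [ht]; ring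
    have e3 : q + σ = μ.real I := by rw [hσ]; ring
    rw [e1, e2, e3]; exact hV4
  have face := face_one_aux hq0 hσ0 ht0 hu0 h4
  -- translate: `v = q + t + u`, `p = 1 − q − σ`, `N = t + u`
  have hv : μ.real F = q + t + u := by rw [ht, hu]; linarith
  have hNN : μ.real (F ∩ Iᶜ) = t + u := by rw [hN, hv]; ring
  rw [hNN, hIc, hv]
  have hp : 1 - μ.real I = 1 - q - σ := by rw [hσ]; ring
  rw [hp]
  nlinarith [face, hq0, hσ0, ht0, hu0]

end Summit.CriticalPhenomena.PercolationContinuityZ3.Theorems.SuperTerminalQuarticFace
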